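import Literature.Computability.Cryptography.HallgrenClassGroup
import Literature.Computability.Cryptography.HallgrenClassGroupDiscriminant
import Literature.Computability.Cryptography.HallgrenClassGroupQuantumKernel
import Literature.Computability.Cryptography.HallgrenClassGroupAssembly
import Literature.Computability.Cryptography.HallgrenClassGroupSingleClassOrder
import Literature.Computability.Cryptography.HallgrenClassGroupIdealCountLower
import Literature.Computability.Cryptography.HallgrenClassGroupTorsionWitnessCount
import Literature.Computability.Cryptography.HallgrenClassGroupCrowdedNorms
import Literature.Computability.Cryptography.HallgrenClassGroupSamplerCount
import Literature.Computability.Cryptography.HallgrenClassGroupReduceFP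
import Literature.Computability.Cryptography.HallgrenClassGroupModArithFP
import Literature.Computability.Cryptography.ClassicalBasePromise
import Literature.Computability.Cryptography.ShorAssemblyLeavesProofs
import Literature.Computability.QuantumComplexity.BQPJoinClosure
import Literature.Computability.QuantumComplexity.PromiseWrap
import Literature.NumberTheory.QuadraticFields.ImaginaryResidueClassNumber
import Literature.NumberTheory.QuadraticFields.ThreeTorsion
import Literature.GroupTheory.FiniteAbelian.TorsionWitnessStatistic
import Literature.Computability.Cryptography.HallgrenClassGroupTorsionWitnessSampler
import Summits.QuantumAdvantage.QuantumAdvantage.Theorems.ArithStatLadderAvgFaceBeyondPriorFactorBits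
import HarnessLib

/-!
# Crux `ArithStatLadder.IqThreeMemBQP` (stmt-QuantumAdvantage-2424), line `scholz-mirror-siegel` — stub `stub_imagWitnessOfBit` (S4b)

Registered stub of the line skeleton `Cruxes/IqThreeMemBQP/Lines/scholz_mirror_siegel.lean` (reshape r5:
the signature below is stated over tree constants only and must stay BYTE-IDENTICAL to the registered
one — edit only the proof and add helper lemmas above it; adjust the imports freely).

Proof summary. The promise problem is decided by ONE one-sided randomized classical machine relative to
the intermediate language `TWBIT` (`Hallgren2005.TorsionWitness.twbLang`:
`⟨bin d, ⟨bin a, bin k⟩⟩ ∈ TWBIT ↔` the `THREEORD` query of the `k`-th form of discriminant `−d` above `a`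
is a YES instance), via `imagWitness_of_oneSidedSampler` (`mem_PromiseBQP_of_FPRel_decider_oneSided`):

* `TWBIT ∈ BQP` (`TorsionWitness.twbLang_mem_BQP`): a coin-using transducer with oracle
  `FB ⊕ THREEORD` reads the factorisation of `a` from the factor-bit language `FB ∈ BQP`
  (`factorBitsLang_mem_BQP`, Shor) through the factor window (`FactorWindow.exists_transducer`), finds
  the square roots of `−d` modulo the prime factors by Cipolla's algorithm from the coins
  (`HallgrenClassGroupCipolla*`, `HallgrenClassGroupRootSlots*`), composes the `k`-th form above `a`
  (`HallgrenClassGroupIdealEnumeration*`) and asks `THREEORD` once; classical base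
  `isQSolvable_of_mem_FPRel_BQP_holds`.
* the sampler (`TorsionWitness.exists_sampler`): trials `(a, k)` from the coins, queries to `TWBIT`,
  output `[d ∈ table ∨ (d ≥ d₀(c) ∧ some YES)]`. No side: a YES query is a valid one-form instance with
  `3 ∣ clGenOrder`, impossible when `3 ∤ h(−d)` (`three_dvd_classNumber_of_three_dvd_clGenOrder`). Yes side:
  the dictionary ideals of norm `a` ↔ indices `k < enumCount` (`ncard_absNorm_eq_eq_card_filter`), the
  count of uncrowded ideals with `3 ∣ ord` (`le_card_ideals_three_dvd_orderOf_uncrowded_of_bright`, from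
  `le_card_ideals_three_dvd_orderOf`, `card_ideals_crowded_le`, brightness
  `le_classNumber_of_dedekindZeta_residue_ge`), pair coverage of a coin block and independent trials
  (`HallgrenClassGroupTorsionWitnessTrial`).
-/

noncomputable section

namespace Summit.QuantumAdvantage.QuantumAdvantage.Theorems.ArithStatLadder.IqThreeMemBQP

open scoped NumberField nonZeroDivisors
open _root_.Computability Literature.Computability.Complexity Literature.Computability.Cryptography
open Literature.Computability.QuantumComplexity
open Literature.NumberTheory.QuadraticFields

/-! ## Helper lemmas -/

/-- **The shape of the remaining obligation** (one-sided classical-base principle specialised to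
the imaginary torsion-witness problem): for `A ∈ BQP` and ONE polynomial-time oracle machine `G`
relative to `A` reading `q(|x|)` coins, if the first output symbol is `1` with probability `≥ 3/4`
on the yes-instances and is `0` for EVERY coin string on the no-instances, the promise problem is in
`PromiseBQP` (`mem_PromiseBQP_of_FPRel_decider_oneSided`, p88536; the two promise sets are disjoint
since `3 ∣ h` and `3 ∤ h` are exclusive and `bin` is injective).
[cite: BennettBernsteinBrassardVazirani1997, Cor. 4.15] -/
theorem imagWitness_of_oneSidedSampler {A : Language Bool} (hA : A ∈ BQP) (c : ℝ)
    (G : List Bool → List Bool) (q : Polynomial ℕ) (hG : G ∈ FPRel (Oracle.ofLanguage A))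
    (hyes : ∀ d : ℕ, IsNegFundamentalDiscr d → 3 ∣ BinaryQuadraticForm.classNumber (-(d : ℤ)) →
      (∀ (K : Type) [Field K] [NumberField K], Module.finrank ℚ K = 2 →
        NumberField.discr K = -(d : ℤ) → c / Real.log d ≤ NumberField.dedekindZeta_residue K) →
      3 / 4 ≤ uniformProb (q.eval (encodeNat d).length) {co | [true] <+: G (boolPair (encodeNat d) co)})
    (hno : ∀ d : ℕ, IsNegFundamentalDiscr d → ¬ 3 ∣ BinaryQuadraticForm.classNumber (-(d : ℤ)) →
      ∀ co : List Bool, [false] <+: G (boolPair (encodeNat d) co)) :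
    (⟨encodingNatBool.toLanguage {d : ℕ | IsNegFundamentalDiscr d ∧
        3 ∣ BinaryQuadraticForm.classNumber (-(d : ℤ)) ∧
        ∀ (K : Type) [Field K] [NumberField K], Module.finrank ℚ K = 2 →
          NumberField.discr K = -(d : ℤ) → c / Real.log d ≤ NumberField.dedekindZeta_residue K},
      encodingNatBool.toLanguage {d : ℕ | IsNegFundamentalDiscr d ∧
        ¬ 3 ∣ BinaryQuadraticForm.classNumber (-(d : ℤ))}⟩ : PromiseProblem) ∈ PromiseBQP := by
  refine mem_PromiseBQP_of_FPRel_decider_oneSided _ ?_ hA G q hG ?_ ?_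
  · refine Set.disjoint_left.2 ?_
    rintro w ⟨d, ⟨-, h3, -⟩, rfl⟩ ⟨d', ⟨-, h3'⟩, hdd'⟩
    have : d' = d := encodingNatBool.encode_injective hdd'
    subst this
    exact h3' h3
  · rintro x ⟨d, ⟨hfund, h3, hbright⟩, rfl⟩
    exact hyes d hfund h3 hbright
  · rintro x ⟨d, ⟨hfund, h3⟩, rfl⟩
    exact hno d hfund h3

/-! ## The registered stub (signature verbatim) -/

/-- **S4b `stub_imagWitnessOfBit`** (XL; test T2, the imaginary torsion-witness sampler). S4a-conclusion → for every
`c > 0` the promise problem (yes: `−d` fundamental, `3 ∣ h(−d)`, every quadratic `K` of discriminant `−d` has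
`κ_K ≥ c/log d`; no: `−d` fundamental, `3 ∤ h(−d)`) is in `PromiseBQP`. Route (S4 worker report, all counts LANDED):
ONE `FP` machine with coins relative to the `BQP` oracle `FACT ⊕ THREEORD` (`oracleJoin_mem_BQP`,
`mem_PromiseBQP_of_FPRel_decider_oneSided` p88536): coins → `a ∈ [1, Y]`; factor `a` through `FACT`; list ALL
ideals of norm `a` of `𝒪_{−d}` as forms (square divisors, square roots of `−d` mod `4a′` by Cipolla/Hensel/CRT,
`ModArithFP`), cap their number at `R = poly(|bin d|)` else give up; pick one by further coins; reduce
(`reduceGC`) to `q`; query `THREEORD` at `encodeClInstance d [q]`; OR over `T = poly` trials. No side: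
deterministic rejection (`three_dvd_classNumber_of_three_dvd_clGenOrder`, p89080). Yes side: per trial
`≥ (1/(Y R))·(#{ideals N ≤ Y with 3 ∣ ord} − #{crowded})` with `le_card_ideals_three_dvd_orderOf` (p90551),
`card_ideals_crowded_le` (p90790), `le_classNumber_of_forall_bright` (p89062), i.e. `≥ c′/(R log d)`. -/
theorem stub_imagWitnessOfBit :
    ({w : List Bool | ∃ (d : ℕ) (q : ℕ × ℤ × ℕ), w = Hallgren2005.encodeClInstance d [q] ∧
        Hallgren2005.IsClInstance d [q] ∧ 3 ∣ Hallgren2005.clGenOrder d [q]} : Language Bool) ∈ BQP →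
      ∀ c : ℝ, 0 < c →
        (⟨encodingNatBool.toLanguage {d : ℕ | IsNegFundamentalDiscr d ∧
            3 ∣ BinaryQuadraticForm.classNumber (-(d : ℤ)) ∧
            ∀ (K : Type) [Field K] [NumberField K], Module.finrank ℚ K = 2 →
              NumberField.discr K = -(d : ℤ) → c / Real.log d ≤ NumberField.dedekindZeta_residue K},
          encodingNatBool.toLanguage {d : ℕ | IsNegFundamentalDiscr d ∧
            ¬ 3 ∣ BinaryQuadraticForm.classNumber (-(d : ℤ))}⟩ : PromiseProblem) ∈ PromiseBQP := by
  intro hTHREE c hc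
  have hFBiff : ∀ (N : ℕ) (u : List Bool),
      boolPair (encodeNat N) u ∈ ({w : List Bool | ∃ (N : ℕ) (u : List Bool), w = boolPair (encodeNat N) u ∧
        (encodingListNatBool.encode (Nat.primeFactorsList N)).getD u.length false = true} : Language Bool) ↔
      (VDSOracle.certCode N.primeFactorsList).getD u.length false = true := by
    intro N u
    simp only [VDSOracle.encode_primeFactorsList_eq]
    constructor
    · rintro ⟨N', u', h, hbit⟩
      obtain ⟨hN, rfl⟩ := Literature.Computability.QuantumComplexity.boolPair_inj.1 h
      rw [Literature.Computability.Complexity.CodeFP.natE_injective hN]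
      exact hbit
    · exact fun h => ⟨N, u, rfl, h⟩
  have hA : Hallgren2005.TorsionWitness.twbLang ∈ BQP :=
    Hallgren2005.TorsionWitness.twbLang_mem_BQP hFBiff
      Summit.QuantumAdvantage.QuantumAdvantage.Theorems.AvgFaceBeyondPrior.Mirror.factorBitsLang_mem_BQP hTHREE
  obtain ⟨S, q, hS, hyes, hno⟩ := Hallgren2005.TorsionWitness.exists_sampler c hc
  exact imagWitness_of_oneSidedSampler hA c S q hS hyes hno

end Summit.QuantumAdvantage.QuantumAdvantage.Theorems.ArithStatLadder.IqThreeMemBQP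

end
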